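import Literature.AlgebraicGeometry.AbelianSchemes.AbelianSchemeIsLambdaOfAtConjugate
import Literature.AlgebraicGeometry.Motives.AbelianVarietyWeilPairingAlternating
import HarnessLib

/-!
# Two `Λ(𝒪(·))`-witnesses of the same polarisation value have linearly equivalent Weil divisors, hence their difference is
# translation-invariant up to linear equivalence ([MFK94] Def. 6.2–6.3; [MumfordAV1970] §8; [Lang] VII §2 Prop. 3)

Topic `AlgebraicGeometry/AbelianSchemes`; namespace `Literature.AlgebraicGeometry.AbelianSchemes.AbelianSchemeOver`.
KERNEL ONLY: theorems; no definition, no named fact, no instance, no `sorry`.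

[MumfordFogartyKirwan1994, Def. 6.2–6.3 (p. 120)]: a polarisation is `λ̄ = Λ(L̄)` for some ample `L̄`, two choices of `L̄`
being allowed; ★ `IsLambdaOfAt` records `Λ(𝒪(Θ))(Q) ≅ t_Q^*𝒪(Θ) ⊗ 𝒪(Θ)⁻¹` read against the Poincaré slice.  The tree's ★
`IsLambdaOfAt.weilPairingLevel_eq` draws the torsion consequence (witness-independence of `ē^Θ_N`); this file draws the
DIVISORIAL one ([MumfordAV1970] §8: `K(Θ₁ − Θ₂) = A`, i.e. `𝒪(Θ₁ − Θ₂) ∈ Pic⁰`):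

* `IsLambdaOfAt.weilDiv_linEquiv` — if `λ̄ = Λ(𝒪(Θ₁)) = Λ(𝒪(Θ₂))` at `s`, then `t_Q^*Θ₂ − Θ₂ ∼ t_Q^*Θ₁ − Θ₁` for every point
  `Q` of the fibre (★ `IsLambdaOfAt.nonempty_iso` twice + ★ (D-2) dictionary
  `weilDiv_linEquiv_iff_nonempty_translateTensorDual_iso`);
* `IsLambdaOfAt.linEquiv_pullback_translation_sub` — hence `t_Q^*(Θ₁ − Θ₂) ∼ Θ₁ − Θ₂` for every `Q` (Cartier-divisor
  bookkeeping: ★ `pullback_add_sameDivisor`, `pullback_neg_sameDivisor`, `telescope_sameDivisor`, `LinEquiv.add`).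
  This is the `hW` clause of ★ `ModuliOfAbelianVarieties.quotient_typeFrame` (Hecke-link socket (B)) once `ψ^*Θ_Q` and
  `ν•Θ′` are known to witness the same `λ̄`.

## References
* [MumfordFogartyKirwan1994] Ch. 6 §2 Def. 6.2–6.3 (p. 120).
* [MumfordAV1970] §8 (the class of `t_x^*D − D`; `K(L)`).
* [Lang1983AbelianVarieties] Ch. VII §2 Prop. 3.
HC_CM is proved only modulo the 7 printed citations until rung 0 closes; this file discharges none of them.
-/

set_option autoImplicit false

noncomputable section

universe u

open CategoryTheory CategoryTheory.Limits AlgebraicGeometry MonoidalCategory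

namespace Literature.AlgebraicGeometry.AbelianSchemes

open Literature.AlgebraicGeometry.Motives Literature.AlgebraicGeometry.AbelianVarieties

namespace AbelianSchemeOver

variable {S : Scheme.{u}} {A : AbelianSchemeOver S} {D : A.DualPair} {lam : A.X ⟶ D.hat.X}
  {Ω : Type u} [Field Ω] {s : Spec (.of Ω) ⟶ S}

/-- **Two `Λ(𝒪(·))`-witnesses of the same `λ̄` have linearly equivalent Weil divisors**: if `λ̄ = Λ(𝒪(Θ₁))` and
`λ̄ = Λ(𝒪(Θ₂))` at `s`, then `t_Q^*Θ₂ − Θ₂ ∼ t_Q^*Θ₁ − Θ₁` for every point `Q` of the fibre `A_s` — both translate-tensor-dual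
bundles are the Poincaré slice at `λ̄(Q)`. [cite: MumfordFogartyKirwan1994, Ch. 6 §2 Definition 6.2–6.3 (p. 120)]
[cite: Lang1983AbelianVarieties, Ch. VII §2 Prop. 3] -/
theorem IsLambdaOfAt.weilDiv_linEquiv {Θ₁ Θ₂ : CartierDivisor (A.fibre s).toAbelianVariety.X.left}
    (h₁ : A.IsLambdaOfAt s D lam Θ₁) (h₂ : A.IsLambdaOfAt s D lam Θ₂) (Q : (A.fibre s).toAbelianVariety.Points Ω) :
    ((A.fibre s).toAbelianVariety.weilDiv Θ₂ Q).LinEquiv ((A.fibre s).toAbelianVariety.weilDiv Θ₁ Q) :=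
  (weilDiv_linEquiv_iff_nonempty_translateTensorDual_iso (A.fibre s).toAbelianVariety Θ₁ Θ₂ Q Q).2
    ⟨(h₂ Q).some.symm ≪≫ (h₁ Q).some⟩

/-- **… hence `Θ₁ − Θ₂` is translation-invariant up to linear equivalence**: `t_Q^*(Θ₁ − Θ₂) ∼ Θ₁ − Θ₂` for every point `Q`
of the fibre ([MumfordAV1970] §8: `K(Θ₁ − Θ₂) = A_s`).  Bookkeeping: `t^*(Θ₁ − Θ₂) = t^*Θ₁ − t^*Θ₂ =
(Θ₁ − t^*Θ₂) + (t^*Θ₁ − Θ₁) ∼ (Θ₁ − t^*Θ₂) + (t^*Θ₂ − Θ₂) = Θ₁ − Θ₂`. [cite: MumfordAV1970, §8 (the divisor class `t_x^*D − D`)]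
[cite: MumfordFogartyKirwan1994, Ch. 6 §2 Definition 6.2–6.3 (p. 120)] -/
theorem IsLambdaOfAt.linEquiv_pullback_translation_sub {Θ₁ Θ₂ : CartierDivisor (A.fibre s).toAbelianVariety.X.left}
    (h₁ : A.IsLambdaOfAt s D lam Θ₁) (h₂ : A.IsLambdaOfAt s D lam Θ₂) (Q : (A.fibre s).toAbelianVariety.Points Ω) :
    (((Θ₁ + -Θ₂).pullback ((A.fibre s).toAbelianVariety.translation Q).left).LinEquiv (Θ₁ + -Θ₂)) := by
  set t := ((A.fibre s).toAbelianVariety.translation Q).left with ht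
  -- `t^*Θ₁ − Θ₁ ∼ t^*Θ₂ − Θ₂`
  have H : (Θ₁.pullback t + -Θ₁).LinEquiv (Θ₂.pullback t + -Θ₂) := (h₁.weilDiv_linEquiv h₂ Q).symm
  -- `t^*(Θ₁ − Θ₂) = t^*Θ₁ − t^*Θ₂`
  have h0 : ((Θ₁ + -Θ₂).pullback t).SameDivisor (Θ₁.pullback t + -(Θ₂.pullback t)) :=
    (CartierDivisor.pullback_add_sameDivisor Θ₁ (-Θ₂) t).trans
      (CartierDivisor.SameDivisor.add (CartierDivisor.SameDivisor.refl _) (CartierDivisor.pullback_neg_sameDivisor t Θ₂))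
  -- `t^*Θ₁ − t^*Θ₂ = (Θ₁ − t^*Θ₂) + (t^*Θ₁ − Θ₁)`
  have h1 : (Θ₁ + -(Θ₂.pullback t) + (Θ₁.pullback t + -Θ₁)).SameDivisor (Θ₁.pullback t + -(Θ₂.pullback t)) :=
    CartierDivisor.telescope_sameDivisor (Θ₂.pullback t) (Θ₁.pullback t) (CartierDivisor.SameDivisor.refl Θ₁)
  -- substitute `H`
  have h2 : (Θ₁ + -(Θ₂.pullback t) + (Θ₁.pullback t + -Θ₁)).LinEquiv (Θ₁ + -(Θ₂.pullback t) + (Θ₂.pullback t + -Θ₂)) :=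
    CartierDivisor.LinEquiv.add (CartierDivisor.LinEquiv.refl _) H
  -- `(Θ₁ − t^*Θ₂) + (t^*Θ₂ − Θ₂) = (t^*Θ₂ − Θ₂) + (Θ₁ − t^*Θ₂) = Θ₁ − Θ₂`
  have h3 : (Θ₁ + -(Θ₂.pullback t) + (Θ₂.pullback t + -Θ₂)).SameDivisor (Θ₁ + -Θ₂) :=
    (CartierDivisor.add_comm_sameDivisor _ _).trans
      (CartierDivisor.telescope_sameDivisor Θ₂ Θ₁ (CartierDivisor.SameDivisor.refl (Θ₂.pullback t)))
  exact ((h0.trans h1.symm).linEquiv.trans h2).trans h3.linEquiv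

end AbelianSchemeOver

end Literature.AlgebraicGeometry.AbelianSchemes

end
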